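import Summits.AtomisticToContinuum.HydrodynamicLimit.Theorems.AntiMazurCoboundariesCorrectorPressureDecayTangentTightnessLaplaceUniqueness

/-!
# Setwise upgrade of vague convergence, II: Laplace convergence gives convergence on bounded continuous functions of the exponential statistics (line `FirstLemma`, crux stmt-AtomisticToContinuum-14135)

Helper file of the registered stub `stub_setwiseWindowLimit_of_domination` (skeleton v10 of line `FirstLemma`, idea
`kifer-compactification`), namespace `Summit.AtomisticToContinuum.HydrodynamicLimit.Theorems.KiferCompactification`.

The SEQUENTIAL version of the Stone–Weierstrass step of the tree's Laplace-uniqueness proof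
(`integral_comp_exp_neg_sumFn_eq`, p143534): if the Laplace functionals `E_{P_j} e^{-∑_{p∈ω} f p}` of probability laws
`P_j` on `PointConfig X` converge to those of a probability law `μ` for every `f ∈ C_c⁺(X)`, then for finitely many
`f₁, …, f_m ∈ C_c⁺(X)` and EVERY bounded continuous `g : ℝ^m → ℝ`,
`∫ g(e^{-S_{f₁}}, …, e^{-S_{f_m}}) dP_j → ∫ g(e^{-S_{f₁}}, …, e^{-S_{f_m}}) dμ` (`S_f ω = ∑_{p ∈ ω} f p`):
monomials in the coordinates are Laplace functionals at `∑ n_k f_k` (tree: `sumFn_sum_natCast_mul`), polynomials by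
linearity, and polynomials approximate `g` uniformly on the cube `[0,1]^m` containing the values of the vector.
Main statement: `tendsto_integral_bcf_expNegSumFn`. No new definitions.

References: O. Kallenberg, *Foundations of Modern Probability*, 2nd ed. (2002), Lemma 12.1 and Thm. 16.16.
-/

noncomputable section

open MeasureTheory Set Filter Topology Function
open scoped ENNReal NNReal BoundedContinuousFunction

namespace Summit.AtomisticToContinuum.HydrodynamicLimit.Theorems.KiferCompactification

open Literature.Analysis.FunctionSpaces (PointConfig)
open Literature.MathematicalPhysics.KineticTheory.PointProcess (laplaceFunctional measurable_exp_neg_finsum)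

variable {X : Type*} [TopologicalSpace X] [T2Space X] [LocallyCompactSpace X] [SecondCountableTopology X]
  [MeasurableSpace X] [BorelSpace X]

/-! ## Bounded continuous functions of the exponential statistics are integrable -/

omit [T2Space X] [LocallyCompactSpace X] [SecondCountableTopology X] [MeasurableSpace X] [BorelSpace X] in
/-- The vector `(e^{-S_{f_k}(ω)})_k` lies in the cube `[0,1]^κ`. -/
theorem exp_neg_sumFn_pi_mem_cube {κ : Type*} {f : κ → X → ℝ} (h0 : ∀ k x, 0 ≤ f k x) (ω : PointConfig X) :
    (fun k => Real.exp (-(ω.sumFn (f k)))) ∈ Set.pi univ fun _ : κ => Icc (0 : ℝ) 1 :=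
  mem_univ_pi.2 fun k => ⟨Real.exp_nonneg _, Real.exp_le_one_iff.2 (neg_nonpos.2 (ω.sumFn_nonneg (h0 k)))⟩

/-- A continuous function of the vector `(e^{-S_{f_k}})_k` is bounded (by its bound on the cube) and hence integrable
under every finite law. -/
theorem integrable_continuousMap_comp_exp_neg_sumFn {κ : Type*} [Fintype κ] {f : κ → X → ℝ}
    (hf : ∀ k, Continuous (f k)) (hcs : ∀ k, HasCompactSupport (f k)) (h0 : ∀ k x, 0 ≤ f k x)
    (q : C(κ → ℝ, ℝ)) (ρ : Measure (PointConfig X)) [IsFiniteMeasure ρ] :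
    Integrable (fun ω : PointConfig X => q fun k => Real.exp (-(ω.sumFn (f k)))) ρ := by
  obtain ⟨M, hM⟩ := (isCompact_univ_pi fun _ : κ => isCompact_Icc).exists_bound_of_continuousOn
    (f := (q : (κ → ℝ) → ℝ)) q.continuous.continuousOn
  exact Integrable.of_bound ((q.continuous.measurable.comp (measurable_exp_neg_sumFn_pi hf hcs h0)).aestronglyMeasurable)
    M (ae_of_all _ fun ω => hM _ (exp_neg_sumFn_pi_mem_cube h0 ω))

/-! ## Monomials and polynomials -/

section Tendsto

variable {P : ℕ → Measure (PointConfig X)} {μ : Measure (PointConfig X)}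

omit [T2Space X] [LocallyCompactSpace X] [SecondCountableTopology X] [BorelSpace X] in
/-- **Monomials**: under Laplace convergence, `∫ ∏ₖ e^{-nₖ S_{fₖ}} dP_j → ∫ ∏ₖ e^{-nₖ S_{fₖ}} dμ` — both sides are
Laplace functionals at `∑ₖ nₖ fₖ ∈ C_c⁺`. -/
theorem tendsto_integral_prod_pow_exp_neg_sumFn {κ : Type*} [Fintype κ]
    (hL : ∀ f : X → ℝ, Continuous f → HasCompactSupport f → (∀ x, 0 ≤ f x) →
      Tendsto (fun j => laplaceFunctional (P j) f) atTop (𝓝 (laplaceFunctional μ f)))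
    {f : κ → X → ℝ} (hf : ∀ k, Continuous (f k)) (hcs : ∀ k, HasCompactSupport (f k))
    (h0 : ∀ k x, 0 ≤ f k x) (n : κ → ℕ) :
    Tendsto (fun j => ∫ ω, ∏ k, Real.exp (-(ω.sumFn (f k))) ^ n k ∂(P j)) atTop
      (𝓝 (∫ ω, ∏ k, Real.exp (-(ω.sumFn (f k))) ^ n k ∂μ)) := by
  set g : X → ℝ := fun x => ∑ k, (n k : ℝ) * f k x with hg
  have hgc : Continuous g := continuous_finsetSum _ fun k _ => continuous_const.mul (hf k)
  have hgs : HasCompactSupport g := by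
    refine HasCompactSupport.intro' (isCompact_iUnion fun k => (hcs k).isCompact)
      (isClosed_iUnion_of_finite fun k => isClosed_tsupport _) fun x hx => ?_
    refine Finset.sum_eq_zero fun k _ => ?_
    have hxk : x ∉ tsupport (f k) := fun h' => hx (mem_iUnion.2 ⟨k, h'⟩)
    rw [image_eq_zero_of_notMem_tsupport hxk, mul_zero]
  have hg0 : ∀ x, 0 ≤ g x := fun x => Finset.sum_nonneg fun k _ => mul_nonneg (Nat.cast_nonneg _) (h0 k x)
  have hpt : ∀ ω : PointConfig X, ∏ k, Real.exp (-(ω.sumFn (f k))) ^ n k = Real.exp (-(ω.sumFn g)) := by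
    intro ω
    rw [hg, sumFn_sum_natCast_mul ω hcs n, ← Finset.sum_neg_distrib, Real.exp_sum]
    refine Finset.prod_congr rfl fun k _ => ?_
    rw [← Real.exp_nat_mul, mul_neg]
  simp_rw [hpt]
  exact hL g hgc hgs hg0

/-- The monomials `x ↦ ∏ₖ (x k)^{nₖ}` exhaust the submonoid of `C(κ → ℝ, ℝ)` generated by the coordinates. -/
private theorem exists_eq_prod_pow_of_mem_closure' {κ : Type*} [Fintype κ] {q : C(κ → ℝ, ℝ)}
    (hq : q ∈ Submonoid.closure
      (Set.range fun k : κ => (⟨fun x => x k, continuous_apply k⟩ : C(κ → ℝ, ℝ)))) :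
    ∃ n : κ → ℕ, ∀ x, q x = ∏ k, x k ^ n k := by
  classical
  induction hq using Submonoid.closure_induction with
  | mem q hq =>
    obtain ⟨k, rfl⟩ := hq
    refine ⟨Pi.single k 1, fun x => ?_⟩
    rw [Finset.prod_eq_single k (fun j _ hj => by rw [Pi.single_eq_of_ne hj, pow_zero])
      (fun h => absurd (Finset.mem_univ k) h)]
    simp
  | one => exact ⟨0, fun x => by simp⟩
  | mul q q' _ _ ih ih' =>
    obtain ⟨n, hn⟩ := ih
    obtain ⟨n', hn'⟩ := ih'
    refine ⟨n + n', fun x => ?_⟩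
    rw [ContinuousMap.mul_apply, hn, hn', ← Finset.prod_mul_distrib]
    refine Finset.prod_congr rfl fun k _ => ?_
    rw [Pi.add_apply, pow_add]

/-- **Polynomials**: under Laplace convergence, `∫ p(e^{-S_{f₁}}, …, e^{-S_{f_m}}) dP_j → ∫ p(…) dμ` for every `p` in
the subalgebra generated by the coordinates (linear span of the monomials). -/
theorem tendsto_integral_comp_exp_neg_sumFn_of_mem_adjoin {κ : Type*} [Fintype κ] [∀ j, IsFiniteMeasure (P j)]
    [IsFiniteMeasure μ]
    (hL : ∀ f : X → ℝ, Continuous f → HasCompactSupport f → (∀ x, 0 ≤ f x) →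
      Tendsto (fun j => laplaceFunctional (P j) f) atTop (𝓝 (laplaceFunctional μ f)))
    {f : κ → X → ℝ} (hf : ∀ k, Continuous (f k)) (hcs : ∀ k, HasCompactSupport (f k))
    (h0 : ∀ k x, 0 ≤ f k x) {p : C(κ → ℝ, ℝ)}
    (hp : p ∈ Algebra.adjoin ℝ
      (Set.range fun k : κ => (⟨fun x => x k, continuous_apply k⟩ : C(κ → ℝ, ℝ)))) :
    Tendsto (fun j => ∫ ω, p (fun k => Real.exp (-(ω.sumFn (f k)))) ∂(P j)) atTop
      (𝓝 (∫ ω, p (fun k => Real.exp (-(ω.sumFn (f k)))) ∂μ)) := by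
  have hint := fun (q : C(κ → ℝ, ℝ)) (ρ : Measure (PointConfig X)) (hρ : IsFiniteMeasure ρ) =>
    integrable_continuousMap_comp_exp_neg_sumFn hf hcs h0 q ρ
  have hp' : p ∈ Submodule.span ℝ ((Submonoid.closure (Set.range fun k : κ =>
      (⟨fun x => x k, continuous_apply k⟩ : C(κ → ℝ, ℝ))) : Set C(κ → ℝ, ℝ))) := by
    rw [← Algebra.adjoin_eq_span]
    exact hp
  clear hp
  induction hp' using Submodule.span_induction with
  | mem q hq =>
    obtain ⟨n, hn⟩ := exists_eq_prod_pow_of_mem_closure' hq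
    simp_rw [hn]
    exact tendsto_integral_prod_pow_exp_neg_sumFn hL hf hcs h0 n
  | zero => simp
  | add q q' _ _ ih ih' =>
    simp only [ContinuousMap.add_apply]
    simp_rw [integral_add (hint q _ inferInstance) (hint q' _ inferInstance)]
    exact ih.add ih'
  | smul a q _ ih =>
    simp only [ContinuousMap.smul_apply, smul_eq_mul]
    simp_rw [integral_const_mul]
    exact ih.const_mul a

/-! ## Bounded continuous functions (Stone–Weierstrass) -/

/-- **Laplace convergence gives convergence on bounded continuous functions of the exponential statistics.** If the
Laplace functionals of probability laws `P_j` converge to those of the probability law `μ` on `C_c⁺(X)`, then for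
`f₁, …, f_m ∈ C_c⁺(X)` and every bounded continuous `g : ℝ^m → ℝ`,
`∫ g(e^{-S_{f₁}}, …, e^{-S_{f_m}}) dP_j → ∫ g(e^{-S_{f₁}}, …, e^{-S_{f_m}}) dμ`: polynomials in the coordinates are
`ε`-close to `g` uniformly on the cube `[0,1]^m` where the vector takes its values
(`ContinuousMap.exists_mem_subalgebra_near_continuous_of_isCompact_of_separatesPoints`), and their integrals converge. -/
theorem tendsto_integral_bcf_expNegSumFn {Y : Type*} [TopologicalSpace Y] [T2Space Y] [LocallyCompactSpace Y]
    [SecondCountableTopology Y] [MeasurableSpace Y] [BorelSpace Y] {P : ℕ → Measure (PointConfig Y)}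
    {μ : Measure (PointConfig Y)} [∀ j, IsProbabilityMeasure (P j)] [IsProbabilityMeasure μ] {κ : Type*} [Fintype κ]
    (hL : ∀ f : Y → ℝ, Continuous f → HasCompactSupport f → (∀ x, 0 ≤ f x) →
      Tendsto (fun j => laplaceFunctional (P j) f) atTop (𝓝 (laplaceFunctional μ f)))
    {f : κ → Y → ℝ} (hf : ∀ k, Continuous (f k)) (hcs : ∀ k, HasCompactSupport (f k)) (h0 : ∀ k x, 0 ≤ f k x)
    (g : (κ → ℝ) →ᵇ ℝ) :
    Tendsto (fun j => ∫ ω, g (fun k => Real.exp (-(ω.sumFn (f k)))) ∂(P j)) atTop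
      (𝓝 (∫ ω, g (fun k => Real.exp (-(ω.sumFn (f k)))) ∂μ)) := by
  set A : Subalgebra ℝ C(κ → ℝ, ℝ) := Algebra.adjoin ℝ
    (Set.range fun k : κ => (⟨fun x => x k, continuous_apply k⟩ : C(κ → ℝ, ℝ))) with hA_def
  have hA : A.SeparatesPoints := by
    intro x y hxy
    obtain ⟨k, hk⟩ := Function.ne_iff.1 hxy
    exact ⟨_, ⟨_, Algebra.subset_adjoin ⟨k, rfl⟩, rfl⟩, hk⟩
  have hgi : ∀ (ρ : Measure (PointConfig Y)) [IsFiniteMeasure ρ],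
      Integrable (fun ω : PointConfig Y => g fun k => Real.exp (-(ω.sumFn (f k)))) ρ := fun ρ _ =>
    integrable_continuousMap_comp_exp_neg_sumFn hf hcs h0 g.toContinuousMap ρ
  rw [Metric.tendsto_atTop]
  intro ε hε
  obtain ⟨p, hpA, hp⟩ := ContinuousMap.exists_mem_subalgebra_near_continuous_of_isCompact_of_separatesPoints hA
    g.toContinuousMap (isCompact_univ_pi fun _ : κ => isCompact_Icc) (show (0 : ℝ) < ε / 3 by positivity)
  have hpi : ∀ (ρ : Measure (PointConfig Y)) [IsFiniteMeasure ρ],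
      Integrable (fun ω : PointConfig Y => p fun k => Real.exp (-(ω.sumFn (f k)))) ρ := fun ρ _ =>
    integrable_continuousMap_comp_exp_neg_sumFn hf hcs h0 p ρ
  -- uniform closeness of the integrals of `g` and `p` under any probability law
  have key : ∀ (ρ : Measure (PointConfig Y)) [IsProbabilityMeasure ρ],
      |∫ ω, g (fun k => Real.exp (-(ω.sumFn (f k)))) ∂ρ - ∫ ω, p (fun k => Real.exp (-(ω.sumFn (f k)))) ∂ρ| ≤
        ε / 3 := by
    intro ρ _
    rw [← integral_sub (hgi ρ) (hpi ρ)]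
    refine (abs_integral_le_integral_abs).trans ?_
    calc ∫ ω, |g (fun k => Real.exp (-(ω.sumFn (f k)))) - p (fun k => Real.exp (-(ω.sumFn (f k))))| ∂ρ
        ≤ ∫ _ω, ε / 3 ∂ρ := by
          refine integral_mono_of_nonneg (ae_of_all _ fun ω => abs_nonneg _) (integrable_const _)
            (ae_of_all _ fun ω => ?_)
          have h := (hp _ (exp_neg_sumFn_pi_mem_cube h0 ω)).le
          rw [Real.norm_eq_abs, abs_sub_comm] at h
          exact h
      _ = ε / 3 := by rw [integral_const, probReal_univ, one_smul]
  obtain ⟨N, hN⟩ := Metric.tendsto_atTop.1 (tendsto_integral_comp_exp_neg_sumFn_of_mem_adjoin hL hf hcs h0 hpA)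
    (ε / 3) (by positivity)
  refine ⟨N, fun j hj => ?_⟩
  have h1 := key (P j)
  have h2 := key μ
  have h3 := hN j hj
  rw [Real.dist_eq] at h3 ⊢
  rw [abs_sub_lt_iff]
  rw [abs_sub_lt_iff] at h3
  rw [abs_le] at h1 h2
  constructor <;> linarith [h1.1, h1.2, h2.1, h2.2, h3.1, h3.2]

end Tendsto

end Summit.AtomisticToContinuum.HydrodynamicLimit.Theorems.KiferCompactification

end
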